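import Summits.BirchSwinnertonDyer.Rank1Residual.X11b.Three.GoodReductionSubgroupReductionMapH1
import Summits.BirchSwinnertonDyer.Rank1Residual.X11b.Three.GoodReductionSubgroupNodeFrobenius
import Literature.NumberTheory.EllipticCurves.ReductionHomomorphismSurjectiveProofs
import Mathlib.FieldTheory.Finite.Basic
import HarnessLib

/-!
# X11b at `p = 3` (team N8/O2), JET3-KUMMER (α): the `Ẽ_ns` half DISCHARGED at a multiplicative
# place whose node is presented over the residue field (Hilbert 90 on `kˣ`, Hensel, Frobenius)

HONEST FRAMING (cell `b2b-bsdres`, run/shared/lean/b2b/bsd-rank1-residual/, verbatim in every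
file): the goal of the cell is to DELETE the COMBINATION-SHAPED residual classes of the
Birch–Swinnerton-Dyer formula for ALL analytic-rank `≤ 1` elliptic curves over `ℚ` — "full BSD
formula for every rank `≤ 1` curve in class `C`" assembled STRICTLY from published theorems — so
that the rank-`≤ 1` remainder becomes exactly the CONSTRUCTION-SHAPED classes, which are TYPED
(missing-input `Prop`s), NOT attempted. This is not "finishing BSD". Team N8/O2 = `x11b3`, seat
`b2b-bsdres-x11b3-p4`, LEAD DEAL #4 row "JET3-KUMMER help-wanted (d) + (α)", part 5 (assembly of
parts 3–4). THEOREMS ONLY: no definition, no named fact, no `sorry`; nothing is booked; the flag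
`JET@p|N` is NOT discharged; the formal-group half `h1ker` stays a NAMED STUB.

## What

In p1's dictionary (`JetchevKummerAtP`: `X / F`, `L ⊇ F`, abstract discrete valuation ring `R` with
`Frac R = L`, `Gal = L ≃ₐ[F] L`, `E₀(L) = goodReductionSubgroup R (X ⊗ L)`), at a place where the
reduction of the `R`-model `W₀` of `X ⊗ L` is a NODE PRESENTED over the residue field `k`
(`W₀ mod 𝔪 = singularModel x₀ y₀ α₁ α₂`, `α₁ ≠ α₂`; at `v ∣ p ∥ N` the reduction is multiplicative,
and over the finite `k` the node is presented as soon as its slopes lie in `k` — always for split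
multiplicative reduction over `K_v`, and for non-split reduction when `[k : k_v]` is even), with
`R` henselian (complete), `k` finite of order `qⁿ`, `φ ∈ Gal` inducing `x ↦ x^q` on `k` (the
Frobenius of the unramified `L/K_v`, `q = #k_v`, `n = [L : K_v]`) and all of `Gal` preserving `R`:

* `h1red_of_node` — **the stub `h1red` HOLDS** for `E₁ = E₁(L)` (the points reducing to `O`):
  every `m ∈ E₀(L)` with `Σ_{j<n} φʲ m = O` is congruent modulo `E₁(L)` to `φ c − c` for some
  `c ∈ E₀(L)`. Proof = parts 3–4: the node reduction map `r : E₀(L) → kˣ` (tree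
  `exists_addMonoidHom_units_of_map_eq_singularModel`, kernel `E₁(L)`) is surjective (Hensel, tree
  `exists_equation_residue_eq`, and `ψ` onto, tree `singularModel.nodeHom_surjective`),
  `φ`-equivariant through `σ̄ = Frob_q` up to inversion (part 4), and `H¹(⟨Frob_q^{±1}⟩, kˣ) = 0`
  in cyclic form (part 3: `kˣ` cyclic of order `qⁿ − 1 = (Σ qʲ)(q − 1) = (Σ (−q)ʲ)(−q − 1)`, the
  latter for `n` even, which is forced when `Frob_q` swaps the slopes).
* `hα_of_h1ker_of_node` — hence p1's hypothesis **(α) follows from the formal-group stub `h1ker`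
  alone** (on `E₁(L)`) at such a place; and `exists_baseChange_eq_add_pow_smul_of_h1ker_of_node` —
  the end form `T ∈ E₀(K_v) + p^m E(K_v)` of part 2 with (α) so replaced.

Not covered (stated, not hidden): a non-split node that stays non-split over `k` (`E` non-split
multiplicative at `v` and `[k : k_v]` odd) — there `Ẽ_ns(k)` is the norm-one torus; reduce to the
even case by the quadratic unramified extension and inflation, or treat the twisted form directly.

References (locators only; no new fact): [cite: SilvermanAEC2009, VII.2 Prop. 2.1 (PDF p. 167),
Exercise 3.5(a) (PDF p. 97), VII.§5 (PDF p. 174)] [cite: MilneADT2006, Ch. I Prop. 3.8]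
[cite: SerreLocalFields1979, VIII §4, X §1].

## Design

No definitions; `noncomputable section`; `open scoped Classical`. The restriction of `φ` to
`E₀(L)`, the transported reduction map and the endomorphism `±Frob_q` of `Additive (IsLocalRing.ResidueField R)ˣ` are built
inside the proof. Axioms: `propext`, `Classical.choice`, `Quot.sound`.
-/

noncomputable section

open scoped Classical

namespace Summit.BirchSwinnertonDyer.Rank1Residual.X11b.Three.JetchevKummer

open WeierstrassCurve Literature.NumberTheory.EllipticCurves

universe u

variable {F : Type u} [Field F] (X : WeierstrassCurve F) (L : Type u) [Field L] [Algebra F L]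
  (R : Type*) [CommRing R] [IsDomain R] [IsDiscreteValuationRing R] [Algebra R L]
  [IsFractionRing R L] [(X.baseChange L).IsMinimal R]
  [HenselianRing R (IsLocalRing.maximalIdeal R)] [Finite (IsLocalRing.ResidueField R)]
  (W₀ : WeierstrassCurve R) (hX : X.baseChange L = W₀.baseChange L)

omit [HenselianRing R (IsLocalRing.maximalIdeal R)] [Finite (IsLocalRing.ResidueField R)] in
/-- The points of `X ⊗ L` reducing to `O` (`E₁(L)`: `O` and the points with non-integral `x`)
lie in `E₀(L)`. Silverman, *AEC* VII.2 (`E₁ ⊆ E₀`). [folklore] -/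
theorem mem_goodReductionSubgroup_of_reducesToZero (Q : (X.baseChange L).toAffine.Point)
    (hQ : ∀ (x y : L) (h : (X.baseChange L).toAffine.Nonsingular x y), Q = .some x y h →
      x ∉ Set.range (algebraMap R L)) :
    Q ∈ (X.baseChange L).goodReductionSubgroup R := by
  rw [WeierstrassCurve.mem_goodReductionSubgroup_iff_holds R (X.baseChange L) Q]
  rcases Q with _ | ⟨x, y, h⟩
  · trivial
  · exact Or.inl (hQ x y h rfl)

include hX in
/-- **The `Ẽ_ns` half of (α) at a place with a presented node** (the stub `h1red` of
`hα_of_cyclic_of_halves` HOLDS for `E₁ = E₁(L)`). Hypotheses: every `τ ∈ Aut(L/F)` preserves `R`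
(`hR`); `W₀` an `R`-model of the `R`-minimal `X ⊗ L` (`hX`) with `W₀ mod 𝔪 = singularModel x₀ y₀ α₁ α₂`,
`α₁ ≠ α₂` (a node presented over the residue field `k`); `R` henselian, `k` finite with
`#k = qⁿ`; `φ ∈ Aut(L/F)` inducing `x ↦ x^q` on `k` (`hfrob`). Conclusion: every `m ∈ E₀(L)` with
`Σ_{j<n} φʲ m = O` is `≡ φ c − c (mod E₁(L))` for some `c ∈ E₀(L)`. Proof: the node reduction map
`r : E₀(L) ↠ kˣ` (kernel `E₁(L)`; onto by Hensel and `ψ` onto) satisfies `r(φ P) = (r P)^{±q}`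
(part 4), and `H¹` of `kˣ` for `u ↦ u^{±q}` vanishes in cyclic form (part 3; in the `−` case `n` is
even because `Frob_q` swaps `α₁ ≠ α₂` and `Frob_qⁿ = 1`). Silverman *AEC* VII.2.1, Ex. 3.5(a);
Hilbert 90. [cite: SilvermanAEC2009, VII.2 Prop. 2.1 and Exercise 3.5(a) (PDF pp. 167, 97)]
[cite: SerreLocalFields1979, X §1 (Hilbert 90)] -/
theorem h1red_of_node
    (hR : ∀ (τ : L ≃ₐ[F] L) (x : L), x ∈ Set.range (algebraMap R L) →
      τ x ∈ Set.range (algebraMap R L))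
    {x₀ y₀ α₁ α₂ : IsLocalRing.ResidueField R}
    (hW : W₀.map (IsLocalRing.residue R) = singularModel x₀ y₀ α₁ α₂) (hα : α₁ ≠ α₂)
    (φ : L ≃ₐ[F] L) {q n : ℕ} (hcard : Nat.card (IsLocalRing.ResidueField R) = q ^ n)
    (hfrob : ∀ a : R, ∃ a' : R, algebraMap R L a' = φ (algebraMap R L a) ∧
      IsLocalRing.residue R a' = IsLocalRing.residue R a ^ q) :
    ∀ m ∈ (X.baseChange L).goodReductionSubgroup R, ∑ j ∈ Finset.range n, (φ ^ j) • m = 0 →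
      ∃ c ∈ (X.baseChange L).goodReductionSubgroup R, m - (φ • c - c) ∈
        {Q : (X.baseChange L).toAffine.Point | ∀ (x y : L)
          (h : (X.baseChange L).toAffine.Nonsingular x y), Q = .some x y h →
            x ∉ Set.range (algebraMap R L)} := by
  have hv := integers_valuationRing_valuation R L
  have hinj : Function.Injective (algebraMap R L) := IsFractionRing.injective R L
  haveI : Fintype (IsLocalRing.ResidueField R) := Fintype.ofFinite _
  -- the node reduction map `r : E₀ → kˣ` and its Galois behaviour
  obtain ⟨r, hr0, hr⟩ := W₀.exists_addMonoidHom_units_of_map_eq_singularModel (K := L) hv hW hα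
  obtain ⟨σk, hσres, hstable, hx₀, hy₀, hcases⟩ :=
    exists_residueMap_nodeReduction_smul X L R W₀ hX hR φ hW r hr0 hr
  -- `σ̄` is the `q`-Frobenius of `k`
  have hσk : ∀ x : IsLocalRing.ResidueField R, σk x = x ^ q := by
    intro x
    obtain ⟨a, rfl⟩ := IsLocalRing.residue_surjective x
    obtain ⟨a', ha', hres⟩ := hfrob a
    rw [hσres a a' ha', hres]
  have hσku : ∀ u : (IsLocalRing.ResidueField R)ˣ, Units.map (σk : IsLocalRing.ResidueField R →* IsLocalRing.ResidueField R) u = u ^ q := fun u ↦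
    Units.ext (by rw [Units.coe_map, MonoidHom.coe_coe, hσk, Units.val_pow_eq_pow_val])
  have hcardF : Fintype.card (IsLocalRing.ResidueField R) = q ^ n := by rw [← Nat.card_eq_fintype_card, hcard]
  have hiter : ∀ (j : ℕ) (x : IsLocalRing.ResidueField R), (⇑σk)^[j] x = x ^ q ^ j := by
    intro j x
    induction j with
    | zero => simp
    | succ j ih => rw [Function.iterate_succ_apply', ih, hσk, ← pow_mul, ← pow_succ]
  have hσkn : ∀ x : IsLocalRing.ResidueField R, (⇑σk)^[n] x = x := fun x ↦ by
    rw [hiter, ← hcardF, FiniteField.pow_card]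
  -- the membership bridge and the transport `T : E₀ (Tamagawa) → E₀ (ReductionHomomorphism)`
  have memiff := mem_goodReductionSubgroup_iff_hasNonsingularReduction_congrEquiv X L R W₀ hX
  let T : (X.baseChange L).goodReductionSubgroup R →+ W₀.nonsingularReductionSubgroup hv :=
    { toFun := fun b ↦ ⟨Affine.Point.congrEquiv hX (b : (X.baseChange L).toAffine.Point),
        (memiff _).mp b.2⟩
      map_zero' := Subtype.ext (by simp only [AddSubgroup.coe_zero, map_zero])
      map_add' := fun a b ↦ Subtype.ext (by simp only [AddSubgroup.coe_add, map_add]) }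
  have hT : ∀ b : (X.baseChange L).goodReductionSubgroup R, (T b : (W₀.baseChange L).toAffine.Point) =
      Affine.Point.congrEquiv hX (b : (X.baseChange L).toAffine.Point) := fun _ ↦ rfl
  let r' : (X.baseChange L).goodReductionSubgroup R →+ Additive (IsLocalRing.ResidueField R)ˣ := r.comp T
  have hr' : ∀ b : (X.baseChange L).goodReductionSubgroup R, r' b = r (T b) := fun _ ↦ rfl
  -- the restriction of `φ` to `E₀(L)`
  let φB : (X.baseChange L).goodReductionSubgroup R →+ (X.baseChange L).goodReductionSubgroup R :=
    { toFun := fun b ↦ ⟨φ • (b : (X.baseChange L).toAffine.Point),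
        smul_mem_goodReductionSubgroup X L R hR φ b.2⟩
      map_zero' := Subtype.ext (smul_zero φ)
      map_add' := fun a b ↦ Subtype.ext (smul_add φ _ _) }
  have hφB : ∀ b : (X.baseChange L).goodReductionSubgroup R,
      ((φB b : (X.baseChange L).goodReductionSubgroup R) : (X.baseChange L).toAffine.Point) =
      φ • (b : (X.baseChange L).toAffine.Point) := fun _ ↦ rfl
  -- `r'` is surjective (Hensel + `ψ` onto)
  have hsurj : Function.Surjective r' := by
    intro t
    obtain ⟨Pt, hPt⟩ := singularModel.nodeHom_surjective (x₀ := x₀) (y₀ := y₀) hα t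
    rcases Pt with _ | ⟨xb, yb, hns⟩
    · refine ⟨0, ?_⟩
      rw [map_zero, ← hPt]
      exact (map_zero _).symm
    · have hns' : (W₀.map (IsLocalRing.residue R)).toAffine.Nonsingular xb yb := by
        rw [hW]; exact hns
      obtain ⟨a, b, heq, hxa, hyb⟩ := W₀.exists_equation_residue_eq hns'
      have hnsab : (W₀.map (IsLocalRing.residue R)).toAffine.Nonsingular (IsLocalRing.residue R a)
          (IsLocalRing.residue R b) := by rw [hxa, hyb]; exact hns'
      have hnsab' : (singularModel x₀ y₀ α₁ α₂).toAffine.Nonsingular (IsLocalRing.residue R a)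
          (IsLocalRing.residue R b) := by rw [← hW]; exact hnsab
      have h : (W₀.baseChange L).toAffine.Nonsingular (algebraMap R L a) (algebraMap R L b) :=
        W₀.nonsingular_baseChange_of_nonsingular_residue (K := L) heq hnsab
      have hP₀ : W₀.HasNonsingularReduction (.some _ _ h) :=
        (hasNonsingularReduction_some_algebraMap_iff hinj h).mpr hnsab
      have hb₀ : (Affine.Point.congrEquiv hX).symm (.some _ _ h) ∈
          (X.baseChange L).goodReductionSubgroup R := by
        rw [memiff, AddEquiv.apply_symm_apply]
        exact hP₀
      refine ⟨⟨_, hb₀⟩, ?_⟩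
      have hTb : T ⟨_, hb₀⟩ = ⟨.some _ _ h, hP₀⟩ := Subtype.ext (AddEquiv.apply_symm_apply _ _)
      rw [hr', hTb, ← hPt]
      apply Additive.toMul.injective
      apply Units.ext
      rw [hr a b h hnsab' hP₀, singularModel.coe_toMul_nodeHom]
      exact congrArg _ (point_some_congr hxa hyb)
  -- the kernel of `r'` consists of points reducing to `O`
  have hker : (r'.ker.map ((X.baseChange L).goodReductionSubgroup R).subtype :
      Set (X.baseChange L).toAffine.Point) ⊆
      {Q : (X.baseChange L).toAffine.Point | ∀ (x y : L)
        (h : (X.baseChange L).toAffine.Nonsingular x y), Q = .some x y h →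
          x ∉ Set.range (algebraMap R L)} := by
    rintro _ ⟨b, hb, rfl⟩ x y h hbxy
    have hb' : r (T b) = 0 := hb
    have h0 := (hr0 (T b)).mp hb'
    rw [hT, AddSubgroup.subtype_apply] at *
    rw [hbxy, Affine.Point.congrEquiv_some] at h0
    exact h0
  -- a generator of `kˣ` and its order `qⁿ − 1`
  obtain ⟨g, hg⟩ := IsCyclic.exists_generator (α := (IsLocalRing.ResidueField R)ˣ)
  have hgA : ∀ c : Additive (IsLocalRing.ResidueField R)ˣ, c ∈ AddSubgroup.zmultiples (Additive.ofMul g) := by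
    intro c
    obtain ⟨z, hz⟩ := Subgroup.mem_zpowers_iff.mp (hg (Additive.toMul c))
    exact AddSubgroup.mem_zmultiples_iff.mpr ⟨z, by rw [← ofMul_zpow, hz]; rfl⟩
  have hone_le : 1 ≤ q ^ n := by rw [← hcard]; exact Nat.card_pos
  have hN : addOrderOf (Additive.ofMul g) = q ^ n - 1 := by
    rw [addOrderOf_ofMul_eq_orderOf, orderOf_eq_card_of_forall_mem_zpowers hg, Nat.card_units,
      hcard]
  have hN0 : 0 < q ^ n - 1 := by
    rw [← hN]; exact addOrderOf_pos_iff.mpr (isOfFinAddOrder_of_finite _)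
  have hNZ : ((q ^ n - 1 : ℕ) : ℤ) = (q : ℤ) ^ n - 1 := by
    rw [Nat.cast_sub hone_le, Nat.cast_pow, Nat.cast_one]
  -- the common final step
  have main : ∀ (φC : Additive (IsLocalRing.ResidueField R)ˣ →+ Additive (IsLocalRing.ResidueField R)ˣ) (a : ℤ), (∀ c, φC c = a • c) →
      (∀ b, r' (φB b) = φC (r' b)) →
      (∑ j ∈ Finset.range n, a ^ j) * (a - 1) = ((q ^ n - 1 : ℕ) : ℤ) →
      ∀ m ∈ (X.baseChange L).goodReductionSubgroup R, ∑ j ∈ Finset.range n, (φ ^ j) • m = 0 →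
        ∃ c ∈ (X.baseChange L).goodReductionSubgroup R, m - (φ • c - c) ∈
          {Q : (X.baseChange L).toAffine.Point | ∀ (x y : L)
            (h : (X.baseChange L).toAffine.Nonsingular x y), Q = .some x y h →
              x ∉ Set.range (algebraMap R L)} := by
    intro φC a hφC hcomm hS m hm hs
    obtain ⟨c, hcB, hc⟩ := h1red_of_reductionMap_of_cyclic ((X.baseChange L).goodReductionSubgroup R)
      φB hφB φC r' hsurj hcomm
      (Additive.ofMul g) hgA hN hN0 hφC hS m hm hs
    exact ⟨c, hcB, hker hc⟩
  -- the transported value of `r` on a moved point, at the level of units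
  have hval : ∀ b : (X.baseChange L).goodReductionSubgroup R, ∃ (hP : W₀.HasNonsingularReduction
      (Affine.Point.congrEquiv hX (b : (X.baseChange L).toAffine.Point)))
      (hσP : W₀.HasNonsingularReduction
        (Affine.Point.congrEquiv hX (φ • (b : (X.baseChange L).toAffine.Point)))),
      r' b = r ⟨_, hP⟩ ∧ r' (φB b) = r ⟨_, hσP⟩ :=
    fun b ↦ ⟨(memiff _).mp b.2, (memiff _).mp (φB b).2, rfl, rfl⟩
  rcases hcases with ⟨h₁, h₂, hplus⟩ | ⟨h₁, h₂, hminus⟩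
  · -- SPLIT node: `r(φ P) = (r P)^q`
    refine main (MonoidHom.toAdditive (Units.map (σk : IsLocalRing.ResidueField R →* IsLocalRing.ResidueField R))) q (fun c ↦ ?_) (fun b ↦ ?_) ?_
    · rw [MonoidHom.toAdditive_apply_apply, hσku, ofMul_pow, ofMul_toMul, natCast_zsmul]
    · obtain ⟨hP, hσP, e1, e2⟩ := hval b
      rw [e1, e2, MonoidHom.toAdditive_apply_apply]
      apply Additive.toMul.injective
      apply Units.ext
      rw [toMul_ofMul, Units.coe_map, MonoidHom.coe_coe]
      exact hplus _ hP hσP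
    · rw [hNZ]; exact sum_pow_mul_sub_one (q : ℤ) n
  · -- NON-SPLIT node (split over `k`): `r(φ P) = (r P)^{-q}`, and `n` is even
    have heven : Even n := by
      rcases Nat.even_or_odd n with hn | ⟨j, rfl⟩
      · exact hn
      · exfalso
        have h2 : (⇑σk)^[2] α₁ = α₁ := by
          show σk (σk α₁) = α₁
          rw [h₁, h₂]
        have hsw : (⇑σk)^[2 * j] α₁ = α₁ := by
          rw [Function.iterate_mul]
          exact Function.iterate_fixed h2 j
        have := hσkn α₁
        rw [show 2 * j + 1 = 1 + 2 * j from add_comm _ _, Function.iterate_add_apply, hsw,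
          Function.iterate_one, h₁] at this
        exact hα this.symm
    refine main (-(MonoidHom.toAdditive (Units.map (σk : IsLocalRing.ResidueField R →* IsLocalRing.ResidueField R)))) (-q) (fun c ↦ ?_)
      (fun b ↦ ?_) ?_
    · rw [AddMonoidHom.neg_apply, MonoidHom.toAdditive_apply_apply, hσku, ofMul_pow, ofMul_toMul,
        neg_smul, natCast_zsmul]
    · obtain ⟨hP, hσP, e1, e2⟩ := hval b
      rw [e1, e2, AddMonoidHom.neg_apply, MonoidHom.toAdditive_apply_apply]
      apply Additive.toMul.injective
      apply Units.ext
      rw [toMul_neg, toMul_ofMul, Units.val_inv_eq_inv_val, Units.coe_map, MonoidHom.coe_coe]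
      exact hminus _ hP hσP
    · rw [hNZ]; exact sum_neg_pow_mul_of_even (q : ℤ) heven

include hX in
/-- **(α) from the formal-group stub alone, at a place with a presented node.** Under the
hypotheses of `h1red_of_node` and with `Gal(L/F) = ⟨φ⟩`, `φⁿ = 1`: if the formal-group half
`h1ker` holds on `E₁(L)` (the points reducing to `O`; printed: `H¹(Gal, Ê(𝔪_L)) = 0` by successive
approximation, Milne *ADT* I.3.8 proof — NAMED STUB), then p1's hypothesis `hα` holds: every
`Q ∈ E(L)` with all `σ Q − Q ∈ E₀(L)` is congruent modulo `E₀(L)` to a `Gal(L/F)`-fixed point.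
[cite: MilneADT2006, Ch. I Prop. 3.8] [cite: SilvermanAEC2009, VII.2 Prop. 2.1, Exercise 3.5(a)] -/
theorem hα_of_h1ker_of_node
    (hR : ∀ (τ : L ≃ₐ[F] L) (x : L), x ∈ Set.range (algebraMap R L) →
      τ x ∈ Set.range (algebraMap R L))
    {x₀ y₀ α₁ α₂ : IsLocalRing.ResidueField R}
    (hW : W₀.map (IsLocalRing.residue R) = singularModel x₀ y₀ α₁ α₂) (hα : α₁ ≠ α₂)
    (φ : L ≃ₐ[F] L) (hφ : ∀ σ : L ≃ₐ[F] L, σ ∈ Subgroup.zpowers φ) {q n : ℕ} (hn : φ ^ n = 1)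
    (hcard : Nat.card (IsLocalRing.ResidueField R) = q ^ n)
    (hfrob : ∀ a : R, ∃ a' : R, algebraMap R L a' = φ (algebraMap R L a) ∧
      IsLocalRing.residue R a' = IsLocalRing.residue R a ^ q)
    (h1ker : ∀ m ∈ {Q : (X.baseChange L).toAffine.Point | ∀ (x y : L)
        (h : (X.baseChange L).toAffine.Nonsingular x y), Q = .some x y h →
          x ∉ Set.range (algebraMap R L)},
      ∑ j ∈ Finset.range n, (φ ^ j) • m = 0 →
        ∃ P ∈ {Q : (X.baseChange L).toAffine.Point | ∀ (x y : L)
          (h : (X.baseChange L).toAffine.Nonsingular x y), Q = .some x y h →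
            x ∉ Set.range (algebraMap R L)}, φ • P - P = m) :
    ∀ Q : (X.baseChange L).toAffine.Point,
      (∀ σ : L ≃ₐ[F] L, σ • Q - Q ∈ (X.baseChange L).goodReductionSubgroup R) →
        ∃ Q' : (X.baseChange L).toAffine.Point, (∀ σ : L ≃ₐ[F] L, σ • Q' = Q') ∧
          Q - Q' ∈ (X.baseChange L).goodReductionSubgroup R :=
  hα_of_cyclic_of_halves X L R φ hφ hn _
    (fun Q hQ ↦ mem_goodReductionSubgroup_of_reducesToZero X L R Q hQ) h1ker
    (h1red_of_node X L R W₀ hX hR hW hα φ hcard hfrob)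

include hX in
/-- **End form at `v` from the formal-group stub alone, at a place with a presented node**:
`exists_baseChange_eq_add_pow_smul` (part 2) with `hstab` discharged from `hR` and (α) replaced by
`h1ker` via `hα_of_h1ker_of_node`: `T = ι(t₀ + p^m t₁)` with `t₀ ∈ E₀(K_v)`, i.e.
`T ∈ E₀(K_v) + p^m E(K_v)` — Jetchev's Prop. 4.1 at `v`, modulo p1's inputs (a), (b), the cocycle
and the ONE remaining stub `h1ker`. [cite: Jetchev2008, Prop. 4.1 (p. 819)]
[cite: MilneADT2006, Ch. I Prop. 3.8] -/
theorem exists_baseChange_eq_add_pow_smul_of_h1ker_of_node [IsGalois F L]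
    (R₀ : Type*) [CommRing R₀] [IsDomain R₀] [IsDiscreteValuationRing R₀] [Algebra R₀ F]
    [IsFractionRing R₀ F] [Algebra R₀ R] [Algebra R₀ L] [IsScalarTower R₀ R L]
    [IsScalarTower R₀ F L] [IsLocalHom (algebraMap R₀ R)] [(X.baseChange F).IsMinimal R₀]
    (hR : ∀ (τ : L ≃ₐ[F] L) (x : L), x ∈ Set.range (algebraMap R L) →
      τ x ∈ Set.range (algebraMap R L))
    {x₀ y₀ α₁ α₂ : IsLocalRing.ResidueField R}
    (hW : W₀.map (IsLocalRing.residue R) = singularModel x₀ y₀ α₁ α₂) (hα : α₁ ≠ α₂)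
    (φ : L ≃ₐ[F] L) (hφ : ∀ σ : L ≃ₐ[F] L, σ ∈ Subgroup.zpowers φ) {q n : ℕ} (hn : φ ^ n = 1)
    (hcard : Nat.card (IsLocalRing.ResidueField R) = q ^ n)
    (hfrob : ∀ a : R, ∃ a' : R, algebraMap R L a' = φ (algebraMap R L a) ∧
      IsLocalRing.residue R a' = IsLocalRing.residue R a ^ q)
    (h1ker : ∀ m ∈ {Q : (X.baseChange L).toAffine.Point | ∀ (x y : L)
        (h : (X.baseChange L).toAffine.Nonsingular x y), Q = .some x y h →
          x ∉ Set.range (algebraMap R L)},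
      ∑ j ∈ Finset.range n, (φ ^ j) • m = 0 →
        ∃ P ∈ {Q : (X.baseChange L).toAffine.Point | ∀ (x y : L)
          (h : (X.baseChange L).toAffine.Nonsingular x y), Q = .some x y h →
            x ∉ Set.range (algebraMap R L)}, φ • P - P = m)
    {p m n' : ℕ} (hcop : Nat.Coprime n' (p ^ m)) {U P T : (X.baseChange L).toAffine.Point}
    {Rσ : (L ≃ₐ[F] L) → (X.baseChange L).toAffine.Point}
    (hT : ∀ σ : L ≃ₐ[F] L, σ • T = T)
    (hP : (n' : ℤ) • P ∈ (X.baseChange L).goodReductionSubgroup R)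
    (hRσ : ∀ σ : L ≃ₐ[F] L, (n' : ℤ) • Rσ σ ∈ (X.baseChange L).goodReductionSubgroup R)
    (hU : ∀ σ : L ≃ₐ[F] L, σ • U - U = Rσ σ) (hpU : ((p ^ m : ℕ) : ℤ) • U = P - T) :
    ∃ t₀ t₁ : (X.baseChange F).toAffine.Point,
      t₀ ∈ (X.baseChange F).goodReductionSubgroup R₀ ∧
      T = Affine.Point.baseChange (W' := X.toAffine) F L (t₀ + ((p ^ m : ℕ) : ℤ) • t₁) :=
  exists_baseChange_eq_add_pow_smul X L R₀ R
    (fun σ _ hQ ↦ smul_mem_goodReductionSubgroup X L R hR σ hQ)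
    (hα_of_h1ker_of_node X L R W₀ hX hR hW hα φ hφ hn hcard hfrob h1ker) hcop hT hP hRσ hU hpU

end Summit.BirchSwinnertonDyer.Rank1Residual.X11b.Three.JetchevKummer

end
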